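import Mathlib
import Summits.Ventures.PercRepro.TriangleCapDeficiency
import Summits.Ventures.PercRepro.TriangleCapSecondGap

/-!
# PercRepro — THE ROWS OF THE OFF-EDGE GRAPH: NEIGHBOUR DEGREES, INSIDE DEGREES, PARTIAL ROWS
(p3, gen 54; part 280)

The off-edge graph `F` of `w` lives on the non-neighbours `L = nonNbrs H w` and the neighbours `N = N(w)`: every
off-edge meets `L` (triangle-freeness), a neighbour `y` of `w` carries the ROW `{x ∈ L : y ~ x}` of size
`k(y) = offDeg H w y ≤ |L|`, and a non-neighbour `x` has off-degree `nbrDeg x + inDeg x` (its neighbours in `N`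
plus its non-neighbour neighbours).  THE PARTIAL ROWS `partialNbrs H w` are the neighbours `y` with
`1 ≤ k(y) ≤ |L| − 1` (a row that is neither empty nor all of `L`).  Facts: `Σ_{x ∈ L} nbrDeg x = attach`
(`sum_nbrDeg_eq_attach`), `Σ_{x ∈ L} inDeg x = 2 |inside|` (`sum_inDeg_eq_two_mul_inside`); THE SPREAD BOUND
`nbrDeg x ≤ nbrDeg x' + |partialNbrs|` for non-neighbours `x, x'` (a row through `x` missing `x'` is partial:
`nbrDeg_le_nbrDeg_add_partial`), and for ADJACENT non-neighbours `nbrDeg x + nbrDeg x' ≤ |partialNbrs|` (their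
rows are disjoint and partial: `nbrDeg_add_nbrDeg_le_partial`); for `|L| = 3 ≤ D` the deficiency of the rows is
`Σ_{y ∈ N} k (D − k) = (D − 3) attach + 2 |partialNbrs|` (`sum_nbr_deficiency_three`).  Axioms: standard.
-/

namespace PercRepro

namespace TriangleCap

namespace C047

open Finset

variable {V : Type*} [Fintype V] [DecidableEq V]

/-- The number of neighbours of `w` adjacent to `x`. -/
def nbrDeg (H : SimpleGraph V) [DecidableRel H.Adj] (w x : V) : ℕ :=
  (univ.filter (fun y => H.Adj w y ∧ H.Adj x y)).card

/-- The number of non-neighbours of `w` adjacent to `x`. -/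
def inDeg (H : SimpleGraph V) [DecidableRel H.Adj] (w x : V) : ℕ :=
  ((nonNbrs H w).filter (fun z => H.Adj x z)).card

/-- The partial rows: the neighbours `y` of `w` with `1 ≤ offDeg y ≤ |nonNbrs| − 1`. -/
def partialNbrs (H : SimpleGraph V) [DecidableRel H.Adj] (w : V) : Finset V :=
  (univ.filter (fun y => H.Adj w y)).filter
    (fun y => 1 ≤ offDeg H w y ∧ offDeg H w y + 1 ≤ (nonNbrs H w).card)

/-- The off-degree of a non-neighbour is `nbrDeg + inDeg`. -/
theorem offDeg_eq_nbrDeg_add_inDeg (H : SimpleGraph V) [DecidableRel H.Adj] (w x : V) (hx : x ∈ nonNbrs H w) :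
    offDeg H w x = nbrDeg H w x + inDeg H w x :=
  offDeg_nonNbr_eq_add H w x hx

/-- `Σ_{x ∈ L} nbrDeg x = attach` (the bipartite edges counted from both sides). -/
theorem sum_nbrDeg_eq_attach (H : SimpleGraph V) [DecidableRel H.Adj] (hfree : H.CliqueFree 3) (w : V) :
    ∑ x ∈ nonNbrs H w, nbrDeg H w x = attach H w := by
  unfold attach nbrDeg
  have h1 : ∀ y ∈ univ.filter (fun y => H.Adj w y),
      offDeg H w y = ∑ x ∈ nonNbrs H w, if H.Adj x y then 1 else 0 := by
    intro y hy
    rw [mem_filter] at hy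
    rw [offDeg_nbr_eq_card H hfree w y hy.2, card_filter]
    apply sum_congr rfl
    intro x _
    by_cases h : H.Adj y x
    · rw [if_pos h, if_pos h.symm]
    · rw [if_neg h, if_neg (fun h' => h h'.symm)]
  rw [sum_congr rfl h1, sum_comm]
  apply sum_congr rfl
  intro x _
  rw [card_filter, sum_filter]
  apply sum_congr rfl
  intro y _
  by_cases h : H.Adj w y <;> simp [h]

/-- `Σ_{x ∈ L} offDeg x = 2 t − attach`. -/
theorem sum_offDeg_nonNbrs_eq (H : SimpleGraph V) [DecidableRel H.Adj] (w : V) :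
    ∑ x ∈ nonNbrs H w, offDeg H w x + attach H w = 2 * (offEdges H w).card := by
  have h := sum_erase_offDeg H w
  rw [sum_erase_eq_nonNbrs_add_nbrs H w] at h
  unfold attach
  exact h

/-- `Σ_{x ∈ L} inDeg x = 2 |inside|` (the inside edges counted from both ends). -/
theorem sum_inDeg_eq_two_mul_inside (H : SimpleGraph V) [DecidableRel H.Adj] (hfree : H.CliqueFree 3) (w : V) :
    ∑ x ∈ nonNbrs H w, inDeg H w x = 2 * (insideEdges H w).card := by
  have h1 := sum_offDeg_nonNbrs_eq H w
  have h2 := sum_nbrDeg_eq_attach H hfree w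
  have h3 := attach_add_card_inside H hfree w
  have h4 : ∑ x ∈ nonNbrs H w, offDeg H w x = ∑ x ∈ nonNbrs H w, nbrDeg H w x + ∑ x ∈ nonNbrs H w, inDeg H w x := by
    rw [← sum_add_distrib]
    apply sum_congr rfl
    intro x hx
    exact offDeg_eq_nbrDeg_add_inDeg H w x hx
  omega

/-- A neighbour `y` of `w` adjacent to the non-neighbour `x` and not to the non-neighbour `x'` is a partial row. -/
theorem mem_partialNbrs_of_adj_not_adj (H : SimpleGraph V) [DecidableRel H.Adj] (hfree : H.CliqueFree 3) (w x x' y : V)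
    (hx : x ∈ nonNbrs H w) (hx' : x' ∈ nonNbrs H w) (hy : H.Adj w y) (hxy : H.Adj x y) (hx'y : ¬ H.Adj x' y) :
    y ∈ partialNbrs H w := by
  unfold partialNbrs
  rw [mem_filter, mem_filter]
  refine ⟨⟨mem_univ _, hy⟩, ?_, ?_⟩
  · rw [offDeg_nbr_eq_card H hfree w y hy]
    apply card_pos.mpr
    exact ⟨x, mem_filter.mpr ⟨hx, hxy.symm⟩⟩
  · rw [offDeg_nbr_eq_card H hfree w y hy]
    have hsub : (nonNbrs H w).filter (fun z => H.Adj y z) ⊆ (nonNbrs H w).erase x' := by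
      intro z hz
      rw [mem_filter] at hz
      rw [mem_erase]
      refine ⟨fun h => hx'y ?_, hz.1⟩
      rw [← h]
      exact hz.2.symm
    have := card_le_card hsub
    rw [card_erase_of_mem hx'] at this
    have hpos : 0 < (nonNbrs H w).card := card_pos.mpr ⟨x', hx'⟩
    omega

/-- **THE SPREAD BOUND:** `nbrDeg x ≤ nbrDeg x' + |partialNbrs|` for non-neighbours `x, x'`. -/
theorem nbrDeg_le_nbrDeg_add_partial (H : SimpleGraph V) [DecidableRel H.Adj] (hfree : H.CliqueFree 3) (w x x' : V)
    (hx : x ∈ nonNbrs H w) (hx' : x' ∈ nonNbrs H w) :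
    nbrDeg H w x ≤ nbrDeg H w x' + (partialNbrs H w).card := by
  unfold nbrDeg
  have hsub : univ.filter (fun y => H.Adj w y ∧ H.Adj x y) ⊆
      univ.filter (fun y => H.Adj w y ∧ H.Adj x' y) ∪ partialNbrs H w := by
    intro y hy
    rw [mem_filter] at hy
    rw [mem_union, mem_filter]
    by_cases h : H.Adj x' y
    · exact Or.inl ⟨mem_univ _, hy.2.1, h⟩
    · exact Or.inr (mem_partialNbrs_of_adj_not_adj H hfree w x x' y hx hx' hy.2.1 hy.2.2 h)
  have := card_le_card hsub
  have := card_union_le (univ.filter (fun y => H.Adj w y ∧ H.Adj x' y)) (partialNbrs H w)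
  omega

/-- **ADJACENT NON-NEIGHBOURS:** `nbrDeg x + nbrDeg x' ≤ |partialNbrs|` when `x ~ x'` (their rows are disjoint
and partial). -/
theorem nbrDeg_add_nbrDeg_le_partial (H : SimpleGraph V) [DecidableRel H.Adj] (hfree : H.CliqueFree 3) (w x x' : V)
    (hx : x ∈ nonNbrs H w) (hx' : x' ∈ nonNbrs H w) (hxx' : H.Adj x x') :
    nbrDeg H w x + nbrDeg H w x' ≤ (partialNbrs H w).card := by
  unfold nbrDeg
  have hdisj : Disjoint (univ.filter (fun y => H.Adj w y ∧ H.Adj x y))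
      (univ.filter (fun y => H.Adj w y ∧ H.Adj x' y)) := by
    rw [disjoint_left]
    intro y hy hy'
    rw [mem_filter] at hy hy'
    exact no_triangle H hfree hxx' hy'.2.2 hy.2.2
  have hsub : univ.filter (fun y => H.Adj w y ∧ H.Adj x y) ∪ univ.filter (fun y => H.Adj w y ∧ H.Adj x' y) ⊆
      partialNbrs H w := by
    intro y hy
    rw [mem_union, mem_filter, mem_filter] at hy
    rcases hy with hy | hy
    · exact mem_partialNbrs_of_adj_not_adj H hfree w x x' y hx hx' hy.2.1 hy.2.2
        (fun h => no_triangle H hfree hxx' h hy.2.2)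
    · exact mem_partialNbrs_of_adj_not_adj H hfree w x' x y hx' hx hy.2.1 hy.2.2
        (fun h => no_triangle H hfree hxx' hy.2.2 h)
  have := card_le_card hsub
  rw [card_union_of_disjoint hdisj] at this
  exact this

/-- The row deficiency at `|L| = 3 ≤ D`: `k (D − k) = (D − 3) k + 2 [1 ≤ k ≤ 2]` for `k ≤ 3`. -/
theorem row_deficiency_three (k D : ℕ) (hk : k ≤ 3) (hD : 3 ≤ D) :
    k * (D - k) = (D - 3) * k + 2 * (if 1 ≤ k ∧ k + 1 ≤ 3 then 1 else 0) := by
  interval_cases k <;> simp <;> omega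

/-- **THE DEFICIENCY OF THE ROWS, `|L| = 3`:** `Σ_{y ∈ N} k(y) (D − k(y)) = (D − 3) attach + 2 |partialNbrs|`. -/
theorem sum_nbr_deficiency_three (H : SimpleGraph V) [DecidableRel H.Adj] (hfree : H.CliqueFree 3) (w : V) (D : ℕ)
    (hℓ : (nonNbrs H w).card = 3) (hD : 3 ≤ D) :
    ∑ y ∈ univ.filter (fun y => H.Adj w y), offDeg H w y * (D - offDeg H w y) =
      (D - 3) * attach H w + 2 * (partialNbrs H w).card := by
  unfold attach partialNbrs
  rw [mul_sum, card_filter, mul_sum, ← sum_add_distrib]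
  apply sum_congr rfl
  intro y hy
  rw [mem_filter] at hy
  have hk := offDeg_le_card_nonNbrs_of_adj H hfree w y hy.2
  rw [hℓ] at hk ⊢
  exact row_deficiency_three _ D hk hD

omit [Fintype V] in
/-- The sum over a three-element set. -/
theorem sum_three_eq (f : V → ℕ) (x₁ x₂ x₃ : V) (h12 : x₁ ≠ x₂) (h13 : x₁ ≠ x₃) (h23 : x₂ ≠ x₃) :
    ∑ x ∈ ({x₁, x₂, x₃} : Finset V), f x = f x₁ + f x₂ + f x₃ := by
  rw [sum_insert (by simp [h12, h13]), sum_insert (by simp [h23]), sum_singleton]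
  ring

omit [Fintype V] in
/-- The cardinality of a filter of a three-element set. -/
theorem card_filter_three (p : V → Prop) [DecidablePred p] (x₁ x₂ x₃ : V) (h12 : x₁ ≠ x₂) (h13 : x₁ ≠ x₃)
    (h23 : x₂ ≠ x₃) :
    (({x₁, x₂, x₃} : Finset V).filter p).card =
      (if p x₁ then 1 else 0) + (if p x₂ then 1 else 0) + (if p x₃ then 1 else 0) := by
  rw [card_filter, sum_three_eq _ x₁ x₂ x₃ h12 h13 h23]

end C047

end TriangleCap

end PercRepro
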